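/-
Copyright (c) 2026. All rights reserved.
Released under Apache 2.0 license as described in the file LICENSE.
Authors: HodgeCM publication cell (pub-hodgecm), GR lane, seat own-crow (`pub-hodgecm-own-crow`).
-/
import Literature.NumberTheory.GelbartRogawski1991.UnitaryDualPairRationalSectionUnique
import Literature.NumberTheory.GelbartRogawski1991.CompatibleSplittingInvariance
import Literature.NumberTheory.Weil1964.AdelicMetaplecticTransport
import Literature.NumberTheory.Automorphic.UnitaryGroupFormTransport
import HarnessLib

/-!
# [GelbartRogawski1991, Prop. 3.1.1] as a record is invariant under `F`-rational congruence of the hermitian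
# Gram data: `(T_V, T_W) ↦ (P_Vᵀ T_V P_V, P_Wᵀ T_W P_W)`

Topic `NumberTheory/GelbartRogawski1991`; namespace `Literature.NumberTheory.GelbartRogawski1991.UnitaryDualPair`
(sequel of `UnitaryDualPairSplittingDatum`, `UnitaryDualPairRationalSectionUnique`, `CompatibleSplittingInvariance`).
KERNEL only: definitions by formula and theorems; no `def … : Prop`, no named fact, no proof hole.

The record `(UnitaryDualPair.splittingDatum F E c N M e (T_V ⊗ 1) (T_W ⊗ 1) …).CompatibleSplitting` ([GR91, Prop. 3.1.1]
for the unitary dual pair `U(T_V) × U(T_W) ⊂ Sp(Res_{E/F}(V ⊗ W))`, `T_V ∈ GL_N(F)`, `T_W ∈ GL_M(F)` symmetric) has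
carriers that DEPEND on the Gram data: `Sp(𝕎_𝔸)` and `Mp_ψ(𝕎_𝔸)ᶜᵒⁿᵗ` of the Gram matrix `𝕋 = reindex e e (T_V ⊗ₖ T_W) ⊗ 1`,
`G₁(𝔸_F) = U(T_V ⊗ T_W)(𝔸_F)` as a matrix group.  Replacing `(T_V, T_W)` by the CONGRUENT data
`(T_V′, T_W′) = (P_Vᵀ T_V P_V, P_Wᵀ T_W P_W)` (`P_V ∈ GL_N(F)`, `P_W ∈ GL_M(F)`) changes every carrier by an
isomorphism, and this file proves that the record moves along:

* `eG : G₁′(𝔸_F) ≃ₜ* G₁(𝔸_F)`, `g ↦ P g P⁻¹`, `P = (P_V ⊗ₖ P_W) ⊗ 1` (`unitaryGroupOfFormCongrOfEq`), carrying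
  `G₁′(F)` into `G₁(F)`;
* `eSp : Sp(𝕎_𝔸) →* Sp(𝕎′_𝔸)`, `x ↦ Λ m x m⁻¹ Λ⁻¹`, with `m = m_𝕋(𝕡⁻¹)` the Siegel–Levi element of the rational matrix
  `𝕡 = reindex e e (P_V ⊗ₖ P_W)` and `Λ = Λ_C : (x, y) ↦ (x, 𝕋′⁻¹ 𝕋 y)` the relabelling of `AdelicMetaplecticTransport`
  (so that `Λ m` is the INVERSE of the restriction of scalars `(x, y) ↦ (𝕡 x, 𝕡 y)` of `P`);
* `φ : Mp_ψ(𝕎_𝔸)ᶜᵒⁿᵗ →* Mp_ψ(𝕎′_𝔸)ᶜᵒⁿᵗ`, `p ↦ relabel_C (q p q⁻¹)`, `q = leviPair 𝕡⁻¹` Weil's Levi pair — continuous,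
  over `eSp`;
* the rational symplectic points correspond (`eSp (ratSp 𝕋 A) = ratSp 𝕋′ (m(𝕡)⁻¹ A m(𝕡))`), and the clause
  "`φ ∘ i ⊆ range i′`" is discharged by the UNIQUENESS of the rational section (`splittingDatum_ratSplit_unique`);

all packaged in the datum form consumed by `SplittingDatum.CompatibleSplitting.transport_of_unique` (`congrDatum_proj_congrMp`,
`congrDatum_ratPts`, `congrDatum_coe_congrSpRat`, with `huniq := splittingDatum_ratSplit_unique`).  NOT HERE (sequel
`UnitaryDualPairSplittingDatumCongruenceTransport`): the remaining hypothesis `ι′ = eSp ∘ ι ∘ eG` (restriction of scalars of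
`P g P⁻¹` against `Λ_C m_𝕋(𝕡⁻¹)`, via `resAut_map`) and the conclusion `compatibleSplitting_congr : CompatibleSplitting (T_V, T_W) →
CompatibleSplitting (P_Vᵀ T_V P_V, P_Wᵀ T_W P_W)`, whose consumer is the END reduction `Prop311.SymmetricCompatibleSplitting ⇐
Prop311.DiagonalCompatibleSplitting` (`Prop311AsPrintedOfRecord`; every symmetric matrix over `F` is congruent to a diagonal one,
`QuadraticForms.exists_congr_diagonal`).

This is the formal content of "(`ρ_ψ` is unique up to isomorphism)" [GR91, p. 454 L21] and "`W` coincides with `V`, but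
viewed as an `F`-vector space" [GR91, p. 454 L41] for a change of the `F`-rational orthogonal basis: Proposition 3.1.1
does not depend on the basis in which the hermitian form is written.  Elementary bookkeeping throughout; the cite
tags on the plumbing lemmas point at the printed sentences whose independence of choices they serve (house style of
`CompatibleSplittingInvariance`).

## References
* [GelbartRogawski1991] S. Gelbart, J. Rogawski, Invent. Math. 105 (1991) 445–472, §3.1 p. 454 L17–42, Prop. 3.1.1 p. 455 L1–3.
* [MoeglinVignerasWaldspurger1987] C. Mœglin, M.-F. Vignéras, J.-L. Waldspurger, LNM 1291 (1987), Chap. 2 II.1 (A)–(B).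
* [Weil1964] A. Weil, Acta Math. 111 (1964), Chap. I n° 13 p. 160 (`d₀(α)`), Chap. III n° 40–41 pp. 190–193 (`r_k`).
-/

set_option autoImplicit false

noncomputable section

open scoped Matrix Kronecker
open NumberField
open Literature.RepresentationTheory.HeisenbergGroup
open Literature.RepresentationTheory.HeisenbergGroup.SymplecticMatrix (transportSp mapHom levi glEquiv leviDual
  leviDual_compat glEquiv_apply leviDual_apply coe_transportSp_apply darboux darboux_apply darboux_symm_apply transportSp_levi
  mapHom_levi coe_levi coe_mapHom)
open Literature.NumberTheory.Automorphic
open Literature.NumberTheory.Automorphic.UnitaryGroup (symplecticGroupCongr coe_symplecticGroupCongr_apply)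
open Literature.NumberTheory.Weil1964

namespace Literature.NumberTheory.GelbartRogawski1991

namespace UnitaryDualPair

/-! ## §0 Matrix algebra of the congruence -/

section Algebra

variable {R : Type*} [CommRing R] {ι κ : Type*} [Fintype ι] [Fintype κ]

/-- `Pᵀ T P` is symmetric when `T` is. [cite: GelbartRogawski1991, §3.1 p. 454 L41–42] -/
theorem isSymm_congr {T : Matrix ι ι R} (hT : T.IsSymm) (P : Matrix ι ι R) : (Pᵀ * T * P).IsSymm := by
  unfold Matrix.IsSymm at hT ⊢
  rw [Matrix.transpose_mul, Matrix.transpose_mul, Matrix.transpose_transpose, hT, Matrix.mul_assoc]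

/-- `det (Pᵀ T P)` is a unit when `det T`, `det P` are. [cite: GelbartRogawski1991, §3.1 p. 454 L41–42] -/
theorem isUnit_det_congr [DecidableEq ι] {T P : Matrix ι ι R} (hT : IsUnit T.det) (hP : IsUnit P.det) :
    IsUnit (Pᵀ * T * P).det := by
  rw [Matrix.det_mul, Matrix.det_mul, Matrix.det_transpose]
  exact (hP.mul hT).mul hP

/-- mixed-product rule: `(P_Vᵀ T_V P_V) ⊗ₖ (P_Wᵀ T_W P_W) = (P_V ⊗ₖ P_W)ᵀ (T_V ⊗ₖ T_W) (P_V ⊗ₖ P_W)`. [cite: GelbartRogawski1991, §3.1 p. 454 L41–42] -/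
theorem kronecker_congr (TV PV : Matrix ι ι R) (TW PW : Matrix κ κ R) :
    (PVᵀ * TV * PV) ⊗ₖ (PWᵀ * TW * PW) = (PV ⊗ₖ PW)ᵀ * (TV ⊗ₖ TW) * (PV ⊗ₖ PW) := by
  rw [UnitaryGroup.kronecker_transpose, ← Matrix.mul_kronecker_mul, ← Matrix.mul_kronecker_mul]

omit [Fintype κ] in
/-- `reindex e e` is multiplicative on square matrices. [cite: GelbartRogawski1991, §3.1 p. 454 L41–42] -/
theorem reindex_mul {ι' : Type*} [Fintype ι'] (e : ι ≃ ι') (A B : Matrix ι ι R) :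
    Matrix.reindex e e (A * B) = Matrix.reindex e e A * Matrix.reindex e e B := by
  rw [Matrix.reindex_apply, Matrix.reindex_apply, Matrix.reindex_apply, Matrix.submatrix_mul_equiv]

end Algebra

section Gram

variable (F : Type) [Field F] [NumberField F] {N M n : ℕ} (e : Fin N × Fin M ≃ Fin n)
variable (TV PV : Matrix (Fin N) (Fin N) F) (TW PW : Matrix (Fin M) (Fin M) F)

omit [NumberField F] in
/-- **the rational Gram matrix of the congruent data**: `𝕋_F′ = 𝕡ᵀ 𝕋_F 𝕡` with `𝕡 = reindex e e (P_V ⊗ₖ P_W) = gram e P_V P_W`.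
[cite: GelbartRogawski1991, §3.1 p. 454 L41–42] -/
theorem gram_congr :
    gram F e (PVᵀ * TV * PV) (PWᵀ * TW * PW) = (gram F e PV PW)ᵀ * gram F e TV TW * gram F e PV PW := by
  rw [gram, gram, gram, kronecker_congr, reindex_mul, reindex_mul, ← Matrix.transpose_reindex]

/-- **the adelic Gram matrix of the congruent data**: `𝕋′ = 𝕡ᵀ 𝕋 𝕡` read in `𝔸_F`. [cite: GelbartRogawski1991, §3.1 p. 454 L41–42] -/
theorem adelicGram_congr :
    adelicGram F e (PVᵀ * TV * PV) (PWᵀ * TW * PW) =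
      (adelicGram F e PV PW)ᵀ * adelicGram F e TV TW * adelicGram F e PV PW := by
  rw [adelicGram_eq_map, adelicGram_eq_map, adelicGram_eq_map, gram_congr, Matrix.map_mul, Matrix.map_mul,
    Matrix.transpose_map]

variable {PV PW}

/-- `𝕡 = gram e P_V P_W` as an element of `GL_n(F)` (`det` a unit). [cite: GelbartRogawski1991, §3.1 p. 454 L41–42] -/
def gramGL (hPV : IsUnit PV.det) (hPW : IsUnit PW.det) : GL (Fin n) F :=
  ((Matrix.isUnit_iff_isUnit_det _).2 (isUnit_det_gram F e hPV hPW)).unit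

omit [NumberField F] in
/-- its matrix. [cite: GelbartRogawski1991, §3.1 p. 454 L41–42] -/
@[simp] theorem coe_gramGL (hPV : IsUnit PV.det) (hPW : IsUnit PW.det) :
    ((gramGL F e hPV hPW : GL (Fin n) F) : Matrix (Fin n) (Fin n) F) = gram F e PV PW := rfl

/-- the matrix of `ratGL 𝕡 ∈ GL_n(𝔸_F)` is the adelic Gram matrix `adelicGram e P_V P_W`. [cite: GelbartRogawski1991, §3.1 p. 454 L41–42] -/
theorem coe_ratGL_gramGL (hPV : IsUnit PV.det) (hPW : IsUnit PW.det) :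
    ((ratGL F (gramGL F e hPV hPW) : GL (Fin n) (AdeleRing (𝓞 F) F)) : Matrix (Fin n) (Fin n) (AdeleRing (𝓞 F) F)) =
      adelicGram F e PV PW := by
  rw [adelicGram_eq_map]; rfl

end Gram

/-! ## §1 The symplectic side: the relabelling `Λ_C`, `C = 𝕋′⁻¹ 𝕋`, intertwines the two Darboux transports -/

section Symplectic

variable (F : Type) [Field F] [NumberField F] {n : ℕ}
variable {T T' : Matrix (Fin n) (Fin n) (AdeleRing (𝓞 F) F)} (hT : IsUnit T.det) (hT' : IsUnit T'.det)

/-- the relabelling matrix `C = 𝕋′⁻¹ 𝕋` satisfies `C 𝕋⁻¹ = 𝕋′⁻¹`. [cite: MoeglinVignerasWaldspurger1987, Chap. 2 II.1 (B)] -/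
theorem relabelGL_mul_inv :
    ((relabelGL F (Fin n) hT' hT : GL (Fin n) (AdeleRing (𝓞 F) F)) : Matrix (Fin n) (Fin n) (AdeleRing (𝓞 F) F)) * T⁻¹ =
      T'⁻¹ := by
  have h : ((relabelGL F (Fin n) hT' hT : GL (Fin n) (AdeleRing (𝓞 F) F)) : Matrix (Fin n) (Fin n) (AdeleRing (𝓞 F) F)) =
      T'⁻¹ * T := by
    conv_lhs => rw [← Matrix.nonsing_inv_mul_cancel_left T' ((relabelGL F (Fin n) hT' hT : GL (Fin n)
      (AdeleRing (𝓞 F) F)) : Matrix (Fin n) (Fin n) (AdeleRing (𝓞 F) F)) hT', mul_relabelGL]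
  rw [h, Matrix.mul_nonsing_inv_cancel_right T _ hT]

/-- `darboux_𝕋 ∘ Λ_C⁻¹ = darboux_{𝕋′}`. [cite: MoeglinVignerasWaldspurger1987, Chap. 2 II.1 (B)] -/
theorem darboux_relabelVec_symm (v : (Fin n → AdeleRing (𝓞 F) F) × (Fin n → AdeleRing (𝓞 F) F)) :
    darboux T hT ((relabelVec F (Fin n) (relabelGL F (Fin n) hT' hT)).symm v) = darboux T' hT' v := by
  rw [relabelVec_symm_apply, darboux_apply, darboux_apply, Matrix.mulVec_mulVec,
    mul_inv_eq_of_relabel F (Fin n) (relabelGL F (Fin n) hT' hT) (mul_relabelGL F (Fin n) hT' hT)]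

/-- `Λ_C ∘ darboux_𝕋⁻¹ = darboux_{𝕋′}⁻¹`. [cite: MoeglinVignerasWaldspurger1987, Chap. 2 II.1 (B)] -/
theorem relabelVec_darboux_symm (u : Fin n ⊕ Fin n → AdeleRing (𝓞 F) F) :
    relabelVec F (Fin n) (relabelGL F (Fin n) hT' hT) ((darboux T hT).symm u) = (darboux T' hT').symm u := by
  rw [darboux_symm_apply, darboux_symm_apply, relabelVec_apply, Matrix.mulVec_mulVec, relabelGL_mul_inv F hT hT']

/-- **`Λ_C ∘ transport_𝕋(B) ∘ Λ_C⁻¹ = transport_{𝕋′}(B)` for every `B ∈ Sp_{2n}(𝔸_F)`**: both Darboux transports factor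
through the standard coordinates and `Λ_C` is their quotient. [cite: MoeglinVignerasWaldspurger1987, Chap. 2 II.1 (B)] -/
theorem symplecticGroupCongr_relabelVec_transportSp (B : Matrix.symplecticGroup (Fin n) (AdeleRing (𝓞 F) F)) :
    symplecticGroupCongr _ _ (relabelVec F (Fin n) (relabelGL F (Fin n) hT' hT))
        (polar_relabelVec F (Fin n) (relabelGL F (Fin n) hT' hT) (mul_relabelGL F (Fin n) hT' hT))
        (transportSp T hT B) = transportSp T' hT' B := by
  apply Subtype.ext
  apply LinearEquiv.ext
  intro v
  rw [coe_symplecticGroupCongr_apply, coe_transportSp_apply, coe_transportSp_apply, darboux_relabelVec_symm F hT hT',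
    relabelVec_darboux_symm F hT hT']

/-- hence **`Λ_C (ratSp_𝕋 A) Λ_C⁻¹ = ratSp_{𝕋′} A`** on the rational symplectic group `Sp_{2n}(F)`. [cite: MoeglinVignerasWaldspurger1987, Chap. 2 II.1 (B)] -/
theorem symplecticGroupCongr_relabelVec_ratSp (A : Matrix.symplecticGroup (Fin n) F) :
    symplecticGroupCongr _ _ (relabelVec F (Fin n) (relabelGL F (Fin n) hT' hT))
        (polar_relabelVec F (Fin n) (relabelGL F (Fin n) hT' hT) (mul_relabelGL F (Fin n) hT' hT))
        (ratSp F T hT A) = ratSp F T' hT' A := by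
  rw [ratSp, ratSp, MonoidHom.comp_apply, MonoidHom.comp_apply, symplecticGroupCongr_relabelVec_transportSp F hT hT']

end Symplectic

/-! ## §2 Weil's Levi pair in the group of record, and the inner conjugation by it -/

section Levi

variable (F : Type) [Field F] [NumberField F] {n : ℕ} (T : Matrix (Fin n) (Fin n) (AdeleRing (𝓞 F) F))
  (hT : IsUnit T.det)

/-- Weil's Levi pair `(m_𝕋(b), Φ ↦ Φ ∘ b⁻¹)` as an element of the group of record `Mp_ψ(𝕎_𝔸)ᶜᵒⁿᵗ`
(`leviPair_mem_adelicMpCont`). [cite: Weil1964, Chap. I n° 13 p. 160] -/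
def leviPairCont (b : GL (Fin n) (AdeleRing (𝓞 F) F)) : adelicMpCont F (Fin n) T :=
  ⟨leviPair F T hT b, leviPair_mem_adelicMpCont F T hT b⟩

/-- underlying pair. [cite: Weil1964, Chap. I n° 13 p. 160] -/
@[simp] theorem coe_leviPairCont (b : GL (Fin n) (AdeleRing (𝓞 F) F)) :
    ((leviPairCont F T hT b : adelicMpCont F (Fin n) T) : adelicMp F (Fin n) T) = leviPair F T hT b := rfl

/-- the operator of a Levi pair is a twist: `(ω(m(b))Ψ)(x) = Ψ(x (b⁻¹)ᵀ)`. [cite: Weil1964, Chap. I n° 13 p. 160] -/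
theorem omegaPsi_leviPair_apply (b : GL (Fin n) (AdeleRing (𝓞 F) F)) (Ψ : piSchwartzBruhat F (Fin n))
    (x : Fin n → AdeleRing (𝓞 F) F) :
    ((omegaPsi (adelicSchrodinger F (Fin n) T) (leviPair F T hT b) Ψ : piSchwartzBruhat F (Fin n)) :
        (Fin n → AdeleRing (𝓞 F) F) → ℂ) x =
      (Ψ : (Fin n → AdeleRing (𝓞 F) F) → ℂ)
        (x ᵥ* ((trInv b : GL (Fin n) (AdeleRing (𝓞 F) F)) : Matrix (Fin n) (Fin n) (AdeleRing (𝓞 F) F))) := by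
  rw [omegaPsi_apply, ← MpPsi.toOp_apply, coe_toOp_leviPair, twist_apply]

/-- **`p ↦ m(b) · p · r` is continuous on `Mp_ψ(𝕎_𝔸)ᶜᵒⁿᵗ`** for the coefficient topology: the orbit maps of `π` are
moved by the fixed linear map `m_𝕋(b)`, and the matrix coefficients `(ω(m(b) p r)Φ)(x) = (ω(p)(ω(r)Φ))(x (b⁻¹)ᵀ)` are
again matrix coefficients. [cite: Weil1964, Chap. III n° 39 p. 189] -/
theorem continuous_leviPairCont_mul_mul (b : GL (Fin n) (AdeleRing (𝓞 F) F)) (r : adelicMpCont F (Fin n) T) :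
    Continuous fun p : adelicMpCont F (Fin n) T => leviPairCont F T hT b * p * r := by
  refine (continuous_into_adelicMpCont_iff _).2 ((continuous_into_adelicMp_iff _).2 ⟨fun w => ?_, fun Φ x => ?_⟩)
  · have hc := (continuous_proj_apply (F := F) (ι := Fin n) (T := T)
      (((MpPsi.proj (adelicSchrodinger F (Fin n) T) (r : adelicMp F (Fin n) T) :
          symplecticGroup (polar (adelicForm F (Fin n) T))) :
        ((Fin n → AdeleRing (𝓞 F) F) × (Fin n → AdeleRing (𝓞 F) F)) ≃ₗ[AdeleRing (𝓞 F) F]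
          ((Fin n → AdeleRing (𝓞 F) F) × (Fin n → AdeleRing (𝓞 F) F))) w)).comp
      (continuous_subtype_val (p := fun p : adelicMp F (Fin n) T => p ∈ adelicMpCont F (Fin n) T))
    simp only [Subgroup.coe_mul, map_mul, coe_leviPairCont, proj_leviPair, LinearEquiv.mul_apply, coe_leviSp_apply,
      glEquiv_apply, leviDual_apply]
    exact (continuous_const.matrix_mulVec (continuous_fst.comp hc)).prodMk
      (continuous_const.matrix_mulVec (continuous_snd.comp hc))
  · have hc := (continuous_omegaPsi_apply (F := F) (ι := Fin n) (T := T)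
      (omegaPsi (adelicSchrodinger F (Fin n) T) (r : adelicMp F (Fin n) T) Φ)
      (x ᵥ* ((trInv b : GL (Fin n) (AdeleRing (𝓞 F) F)) : Matrix (Fin n) (Fin n) (AdeleRing (𝓞 F) F)))).comp
      (continuous_subtype_val (p := fun p : adelicMp F (Fin n) T => p ∈ adelicMpCont F (Fin n) T))
    simp only [Subgroup.coe_mul, map_mul, coe_leviPairCont, Module.End.mul_apply, omegaPsi_leviPair_apply]
    exact hc

/-- **inner conjugation by the Levi pair**, `p ↦ m(b) p m(b)⁻¹`, on `Mp_ψ(𝕎_𝔸)ᶜᵒⁿᵗ`. [cite: Weil1964, Chap. I n° 13 p. 160] -/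
def leviConj (b : GL (Fin n) (AdeleRing (𝓞 F) F)) : adelicMpCont F (Fin n) T →* adelicMpCont F (Fin n) T :=
  (MulAut.conj (leviPairCont F T hT b)).toMonoidHom

/-- formula. [cite: Weil1964, Chap. I n° 13 p. 160] -/
theorem leviConj_apply (b : GL (Fin n) (AdeleRing (𝓞 F) F)) (p : adelicMpCont F (Fin n) T) :
    leviConj F T hT b p = leviPairCont F T hT b * p * (leviPairCont F T hT b)⁻¹ := rfl

/-- `leviConj` is continuous. [cite: Weil1964, Chap. III n° 39 p. 189] -/
theorem continuous_leviConj (b : GL (Fin n) (AdeleRing (𝓞 F) F)) : Continuous (leviConj F T hT b) := by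
  have h := continuous_leviPairCont_mul_mul F T hT b (leviPairCont F T hT b)⁻¹
  exact h.congr fun p => (leviConj_apply F T hT b p).symm

/-- `π(m(b) p m(b)⁻¹) = π(m(b)) π(p) π(m(b))⁻¹`. [cite: Weil1964, Chap. I n° 13 p. 160] -/
theorem proj_leviConj (b : GL (Fin n) (AdeleRing (𝓞 F) F)) (p : adelicMpCont F (Fin n) T) :
    adelicMpCont.proj F (Fin n) T (leviConj F T hT b p) =
      adelicMpCont.proj F (Fin n) T (leviPairCont F T hT b) * adelicMpCont.proj F (Fin n) T p *
        (adelicMpCont.proj F (Fin n) T (leviPairCont F T hT b))⁻¹ :=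
  calc adelicMpCont.proj F (Fin n) T (leviConj F T hT b p)
      = adelicMpCont.proj F (Fin n) T (leviPairCont F T hT b * p * (leviPairCont F T hT b)⁻¹) :=
        congrArg _ (leviConj_apply F T hT b p)
    _ = adelicMpCont.proj F (Fin n) T (leviPairCont F T hT b * p) *
          adelicMpCont.proj F (Fin n) T (leviPairCont F T hT b)⁻¹ := MonoidHom.map_mul _ _ _
    _ = _ := congrArg₂ (· * ·) (MonoidHom.map_mul (adelicMpCont.proj F (Fin n) T) _ _)
        (MonoidHom.map_inv (adelicMpCont.proj F (Fin n) T) _)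

end Levi


/-! ## §3 The unitary side: `g ↦ P g P⁻¹`, `P = (P_V ⊗ₖ P_W) ⊗ 1`, from `U(T_V′ ⊗ T_W′)` to `U(T_V ⊗ T_W)` -/

section Unitary

variable (F E : Type) [Field F] [NumberField F] [Field E] [NumberField E] [Algebra F E]
variable (c : E ≃ₐ[F] E) (N M : ℕ)
variable {PV : Matrix (Fin N) (Fin N) F} {PW : Matrix (Fin M) (Fin M) F} (hPV : IsUnit PV.det) (hPW : IsUnit PW.det)

/-- `P = P_V ⊗ₖ P_W ∈ GL_{N M}(F)`. [cite: GelbartRogawski1991, §3.1 p. 454 L41–42] -/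
def kronGL : GL (Fin N × Fin M) F :=
  ((Matrix.isUnit_iff_isUnit_det _).2 (UnitaryGroup.SpTransport.isUnit_det_kronecker hPV hPW)).unit

omit [NumberField F] in
/-- its matrix. [cite: GelbartRogawski1991, §3.1 p. 454 L41–42] -/
@[simp] theorem coe_kronGL : ((kronGL F N M hPV hPW : GL (Fin N × Fin M) F) : Matrix (Fin N × Fin M) (Fin N × Fin M) F) =
    PV ⊗ₖ PW := rfl

/-- `P ⊗ 1 ∈ GL_{N M}(E)`. [cite: GelbartRogawski1991, §3.1 p. 454 L41–42] -/
def kronGLE : GL (Fin N × Fin M) E := Matrix.GeneralLinearGroup.map (algebraMap F E) (kronGL F N M hPV hPW)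

omit [NumberField F] [NumberField E] in
/-- its matrix. [cite: GelbartRogawski1991, §3.1 p. 454 L41–42] -/
@[simp] theorem coe_kronGLE :
    ((kronGLE F E N M hPV hPW : GL (Fin N × Fin M) E) : Matrix (Fin N × Fin M) (Fin N × Fin M) E) =
      (PV ⊗ₖ PW).map (algebraMap F E) := rfl

/-- `P ⊗ 1 ∈ GL_{N M}(𝔸_E)`, written as the base change of `P ⊗ 1 ∈ GL_{N M}(𝔸_F)` (the shape `resAut_map` consumes).
[cite: GelbartRogawski1991, §3.1 p. 454 L41–42] -/
def kronGLAdele : GL (Fin N × Fin M) (AdeleRing (𝓞 E) E) :=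
  Matrix.GeneralLinearGroup.map (AdeleRing.baseChange F E)
    (Matrix.GeneralLinearGroup.map (algebraMap F (AdeleRing (𝓞 F) F)) (kronGL F N M hPV hPW))

/-- `P ⊗ 1 ∈ GL_{N M}(𝔸_E)` is the image of `P ⊗ 1 ∈ GL_{N M}(E)`. [cite: GelbartRogawski1991, §3.1 p. 454 L41–42] -/
theorem kronGLAdele_eq_map :
    kronGLAdele F E N M hPV hPW = Matrix.GeneralLinearGroup.map (algebraMap E (AdeleRing (𝓞 E) E)) (kronGLE F E N M hPV hPW) := by
  refine Units.ext (Matrix.ext fun i j => ?_)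
  simp only [kronGLAdele, kronGLE, Matrix.GeneralLinearGroup.map_apply]
  exact AdeleRing.baseChange_algebraMap F E _

/-- its matrix. [cite: GelbartRogawski1991, §3.1 p. 454 L41–42] -/
theorem coe_kronGLAdele :
    ((kronGLAdele F E N M hPV hPW : GL (Fin N × Fin M) (AdeleRing (𝓞 E) E)) :
        Matrix (Fin N × Fin M) (Fin N × Fin M) (AdeleRing (𝓞 E) E)) =
      ((PV ⊗ₖ PW).map (algebraMap F (AdeleRing (𝓞 F) F))).map (AdeleRing.baseChange F E) := rfl

/-- `c ⊗ 1` fixes `P ⊗ 1` (its entries lie in `𝔸_F ⊗ 1`). [cite: GelbartRogawski1991, §3.1 p. 454 L41–42] -/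
theorem map_conjAdele_kronGLAdele :
    ((kronGLAdele F E N M hPV hPW : GL (Fin N × Fin M) (AdeleRing (𝓞 E) E)) :
        Matrix (Fin N × Fin M) (Fin N × Fin M) (AdeleRing (𝓞 E) E)).map (UnitaryGroup.conjAdele F E c) =
      (kronGLAdele F E N M hPV hPW : GL (Fin N × Fin M) (AdeleRing (𝓞 E) E)) := by
  refine Matrix.ext fun i j => ?_
  rw [Matrix.map_apply, coe_kronGLAdele, Matrix.map_apply, UnitaryGroup.conjAdele_apply, AdeleRing.smul_baseChange]

omit [NumberField F] [NumberField E] in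
/-- `c` fixes `P ⊗ 1 ∈ GL_{N M}(E)`. [cite: GelbartRogawski1991, §3.1 p. 454 L41–42] -/
theorem map_kronGLE :
    ((kronGLE F E N M hPV hPW : GL (Fin N × Fin M) E) : Matrix (Fin N × Fin M) (Fin N × Fin M) E).map (c : E →+* E) =
      (kronGLE F E N M hPV hPW : GL (Fin N × Fin M) E) := by
  refine Matrix.ext fun i j => ?_
  rw [Matrix.map_apply, coe_kronGLE, Matrix.map_apply, RingHom.coe_coe, AlgEquiv.commutes]

variable (TV : Matrix (Fin N) (Fin N) F) (TW : Matrix (Fin M) (Fin M) F)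

omit [NumberField F] [NumberField E] in
/-- **`(P ⊗ 1)ᵀ (J_V ⊗ J_W) (P ⊗ 1) = J_V′ ⊗ J_W′`** over `E`, `J = T ⊗ 1`, `T′ = Pᵀ T P`. [cite: GelbartRogawski1991, §3.1 p. 454 L41–42] -/
theorem formCongr_kronGLE :
    formCongr (c : E →+* E) (kronGLE F E N M hPV hPW) (TV.map (algebraMap F E) ⊗ₖ TW.map (algebraMap F E)) =
      (PVᵀ * TV * PV).map (algebraMap F E) ⊗ₖ (PWᵀ * TW * PW).map (algebraMap F E) := by
  rw [formCongr, map_kronGLE, coe_kronGLE, UnitaryGroup.kronecker_map_map, UnitaryGroup.kronecker_map_map,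
    kronecker_congr, Matrix.map_mul, Matrix.map_mul, Matrix.transpose_map]

/-- **`(P ⊗ 1)ᵀ (J_V ⊗ J_W ⊗ 1) (P ⊗ 1) = J_V′ ⊗ J_W′ ⊗ 1`** over `𝔸_E`. [cite: GelbartRogawski1991, §3.1 p. 454 L41–42] -/
theorem formCongr_kronGLAdele :
    formCongr (UnitaryGroup.conjAdele F E c) (kronGLAdele F E N M hPV hPW)
        (UnitaryGroup.adelicForm E N (TV.map (algebraMap F E)) ⊗ₖ UnitaryGroup.adelicForm E M (TW.map (algebraMap F E))) =
      UnitaryGroup.adelicForm E N ((PVᵀ * TV * PV).map (algebraMap F E)) ⊗ₖ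
        UnitaryGroup.adelicForm E M ((PWᵀ * TW * PW).map (algebraMap F E)) := by
  rw [formCongr, map_conjAdele_kronGLAdele, coe_kronGLAdele, UnitaryGroup.adelicForm_eq_map_map E N TV rfl,
    UnitaryGroup.adelicForm_eq_map_map E M TW rfl, UnitaryGroup.adelicForm_eq_map_map E N (PVᵀ * TV * PV) rfl,
    UnitaryGroup.adelicForm_eq_map_map E M (PWᵀ * TW * PW) rfl, UnitaryGroup.kronecker_map_map,
    UnitaryGroup.kronecker_map_map, UnitaryGroup.kronecker_map_map, UnitaryGroup.kronecker_map_map, kronecker_congr,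
    Matrix.map_mul, Matrix.map_mul, Matrix.map_mul, Matrix.map_mul, Matrix.transpose_map, Matrix.transpose_map]

/-- **`eG : U(T_V′ ⊗ T_W′)(𝔸_F) ≃ₜ* U(T_V ⊗ T_W)(𝔸_F)`, `g ↦ P g P⁻¹`** (`unitaryGroupOfFormCongrOfEq`).
[cite: GelbartRogawski1991, §3.1 p. 454 L41–42] -/
def congrPair :
    UnitaryGroup.adelicPair F E c N M ((PVᵀ * TV * PV).map (algebraMap F E)) ((PWᵀ * TW * PW).map (algebraMap F E)) ≃ₜ*
      UnitaryGroup.adelicPair F E c N M (TV.map (algebraMap F E)) (TW.map (algebraMap F E)) :=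
  unitaryGroupOfFormCongrOfEq (UnitaryGroup.conjAdele F E c) (kronGLAdele F E N M hPV hPW) _ _
    (formCongr_kronGLAdele F E c N M hPV hPW TV TW)

/-- on underlying invertible matrices `eG g = P g P⁻¹`. [cite: GelbartRogawski1991, §3.1 p. 454 L41–42] -/
@[simp] theorem coe_congrPair_apply
    (g : UnitaryGroup.adelicPair F E c N M ((PVᵀ * TV * PV).map (algebraMap F E)) ((PWᵀ * TW * PW).map (algebraMap F E))) :
    ((congrPair F E c N M hPV hPW TV TW g :
        UnitaryGroup.adelicPair F E c N M (TV.map (algebraMap F E)) (TW.map (algebraMap F E))) :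
      GL (Fin N × Fin M) (AdeleRing (𝓞 E) E)) =
      kronGLAdele F E N M hPV hPW * g * (kronGLAdele F E N M hPV hPW)⁻¹ := rfl

/-- **`eG` carries rational points to rational points**: `P γ P⁻¹ ∈ G₁(F)` for `γ ∈ G₁′(F)` (conjugation by
`P ⊗ 1 ∈ GL_{N M}(E)` inside `GL_{N M}(E)`, then the diagonal embedding). [cite: GelbartRogawski1991, §3.1 p. 455 L1–3] -/
theorem congrPair_rationalPairToAdelic_mem_range
    (γ : UnitaryGroup.rationalPair F E c N M ((PVᵀ * TV * PV).map (algebraMap F E)) ((PWᵀ * TW * PW).map (algebraMap F E))) :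
    congrPair F E c N M hPV hPW TV TW (UnitaryGroup.rationalPairToAdelic F E c N M _ _ γ) ∈
      (UnitaryGroup.rationalPairToAdelic F E c N M (TV.map (algebraMap F E)) (TW.map (algebraMap F E))).range := by
  have hγ : (γ : GL (Fin N × Fin M) E) ∈ unitaryGroupOfForm (c : E →+* E)
      (formCongr (c : E →+* E) (kronGLE F E N M hPV hPW) (TV.map (algebraMap F E) ⊗ₖ TW.map (algebraMap F E))) := by
    rw [formCongr_kronGLE]
    exact γ.2
  refine ⟨⟨kronGLE F E N M hPV hPW * γ * (kronGLE F E N M hPV hPW)⁻¹,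
    conj_mem_unitaryGroupOfForm (c : E →+* E) (kronGLE F E N M hPV hPW) _ hγ⟩, ?_⟩
  refine Subtype.ext (Units.ext ?_)
  rw [UnitaryGroup.coe_rationalPairToAdelic, coe_congrPair_apply, Units.val_mul, Units.val_mul, Units.val_mul,
    Units.val_mul, UnitaryGroup.coe_rationalPairToAdelic, Matrix.map_mul, Matrix.map_mul, kronGLAdele_eq_map,
    ← Matrix.GeneralLinearGroup.map_inv]
  rfl

end Unitary


/-! ## §4 The transport of the record along the congruence -/

section Transport

variable (F E : Type) [Field F] [NumberField F] [Field E] [NumberField E] [Algebra F E]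
variable (c : E ≃ₐ[F] E) {N M n : ℕ} (e : Fin N × Fin M ≃ Fin n)
variable [Algebra.IsQuadraticExtension F E] {δ : E} (hcδ : c δ = -δ) (hδ : δ ≠ 0) {d : F}
  (hd : δ * δ = algebraMap F E d)
variable {TV : Matrix (Fin N) (Fin N) F} {TW : Matrix (Fin M) (Fin M) F}
variable (hV : TV.IsSymm) (hW : TW.IsSymm) (hVd : IsUnit TV.det) (hWd : IsUnit TW.det)
variable {PV : Matrix (Fin N) (Fin N) F} {PW : Matrix (Fin M) (Fin M) F} (hPV : IsUnit PV.det) (hPW : IsUnit PW.det)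

/-- `det 𝕋′` is a unit. [cite: GelbartRogawski1991, §3.1 p. 454 L21–42] -/
theorem isUnit_det_adelicGram_congr (hVd : IsUnit TV.det) (hWd : IsUnit TW.det) (hPV : IsUnit PV.det)
    (hPW : IsUnit PW.det) : IsUnit (adelicGram F e (PVᵀ * TV * PV) (PWᵀ * TW * PW)).det :=
  isUnit_det_adelicGram F e (isUnit_det_congr hVd hPV) (isUnit_det_congr hWd hPW)

/-- the relabelling `Λ_C`, `C = 𝕋′⁻¹ 𝕋`, on the symplectic groups: `Sp(𝕎_𝔸) →* Sp(𝕎′_𝔸)`, `x ↦ Λ_C x Λ_C⁻¹`. [cite: GelbartRogawski1991, §3.1 p. 454 L21–42] -/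
def congrSpRelabel :
    symplecticGroup (polar (adelicForm F (Fin n) (adelicGram F e TV TW))) →*
      symplecticGroup (polar (adelicForm F (Fin n) (adelicGram F e (PVᵀ * TV * PV) (PWᵀ * TW * PW)))) :=
  symplecticGroupCongr _ _
    (relabelVec F (Fin n) (relabelGL F (Fin n) (isUnit_det_adelicGram_congr F e hVd hWd hPV hPW)
      (isUnit_det_adelicGram F e hVd hWd)))
    (polar_relabelVec F (Fin n) _ (mul_relabelGL F (Fin n) (isUnit_det_adelicGram_congr F e hVd hWd hPV hPW)
      (isUnit_det_adelicGram F e hVd hWd)))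

/-- the relabelling of record `Mp_ψ(𝕎_𝔸)ᶜᵒⁿᵗ ≃* Mp_ψ(𝕎′_𝔸)ᶜᵒⁿᵗ` along `C = 𝕋′⁻¹ 𝕋`. [cite: GelbartRogawski1991, §3.1 p. 454 L21–42] -/
def congrMpRelabel :
    adelicMpCont F (Fin n) (adelicGram F e TV TW) ≃* adelicMpCont F (Fin n) (adelicGram F e (PVᵀ * TV * PV) (PWᵀ * TW * PW)) :=
  adelicMpContRelabel F (Fin n)
    (relabelGL F (Fin n) (isUnit_det_adelicGram_congr F e hVd hWd hPV hPW) (isUnit_det_adelicGram F e hVd hWd))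
    (mul_relabelGL F (Fin n) (isUnit_det_adelicGram_congr F e hVd hWd hPV hPW) (isUnit_det_adelicGram F e hVd hWd))

/-- `π′ ∘ relabel = Λ_C (π ·) Λ_C⁻¹`. [cite: GelbartRogawski1991, §3.1 p. 454 L21–42] -/
theorem proj_congrMpRelabel (p : adelicMpCont F (Fin n) (adelicGram F e TV TW)) :
    adelicMpCont.proj F (Fin n) _ (congrMpRelabel F e hVd hWd hPV hPW p) =
      congrSpRelabel F e hVd hWd hPV hPW (adelicMpCont.proj F (Fin n) _ p) := rfl

/-- `Λ_C (ratSp_𝕋 A) Λ_C⁻¹ = ratSp_{𝕋′} A`. [cite: GelbartRogawski1991, §3.1 p. 454 L21–42] -/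
theorem congrSpRelabel_ratSp (A : Matrix.symplecticGroup (Fin n) F) :
    congrSpRelabel F e hVd hWd hPV hPW (ratSp F _ (isUnit_det_adelicGram F e hVd hWd) A) =
      ratSp F _ (isUnit_det_adelicGram_congr F e hVd hWd hPV hPW) A :=
  symplecticGroupCongr_relabelVec_ratSp F _ _ A

/-- Weil's Levi pair `q = (m_𝕋(𝕡⁻¹), Φ ↦ Φ ∘ 𝕡)` of the inverse of the rational congruence matrix
`𝕡 = reindex e e (P_V ⊗ₖ P_W)`, in `Mp_ψ(𝕎_𝔸)ᶜᵒⁿᵗ`. [cite: Weil1964, Chap. I n° 13 p. 160] -/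
def congrLeviPair : adelicMpCont F (Fin n) (adelicGram F e TV TW) :=
  leviPairCont F (adelicGram F e TV TW) (isUnit_det_adelicGram F e hVd hWd) (ratGL F (gramGL F e hPV hPW)⁻¹)

/-- `π(q) = ratSp_𝕋 (m(𝕡⁻¹))` — a RATIONAL symplectic element. [cite: GelbartRogawski1991, §3.1 p. 454 L21–42] -/
theorem proj_congrLeviPair :
    adelicMpCont.proj F (Fin n) _ (congrLeviPair F e hVd hWd hPV hPW) =
      ratSp F _ (isUnit_det_adelicGram F e hVd hWd) (levi (gramGL F e hPV hPW)⁻¹) := by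
  delta congrLeviPair
  rw [ratSp_levi, adelicMpCont.proj_apply, coe_leviPairCont, proj_leviPair]

/-- **`eSp : Sp(𝕎_𝔸) →* Sp(𝕎′_𝔸)`, `x ↦ Λ_C π(q) x π(q)⁻¹ Λ_C⁻¹`.** [cite: GelbartRogawski1991, §3.1 p. 454 L41–42] -/
def congrSp :
    symplecticGroup (polar (adelicForm F (Fin n) (adelicGram F e TV TW))) →*
      symplecticGroup (polar (adelicForm F (Fin n) (adelicGram F e (PVᵀ * TV * PV) (PWᵀ * TW * PW)))) :=
  (congrSpRelabel F e hVd hWd hPV hPW).comp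
    (MulAut.conj (adelicMpCont.proj F (Fin n) _ (congrLeviPair F e hVd hWd hPV hPW))).toMonoidHom

/-- formula. [cite: GelbartRogawski1991, §3.1 p. 454 L21–42] -/
theorem congrSp_apply (x : symplecticGroup (polar (adelicForm F (Fin n) (adelicGram F e TV TW)))) :
    congrSp F e hVd hWd hPV hPW x =
      congrSpRelabel F e hVd hWd hPV hPW
        (adelicMpCont.proj F (Fin n) _ (congrLeviPair F e hVd hWd hPV hPW) * x *
          (adelicMpCont.proj F (Fin n) _ (congrLeviPair F e hVd hWd hPV hPW))⁻¹) := rfl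

/-- **`φ : Mp_ψ(𝕎_𝔸)ᶜᵒⁿᵗ →* Mp_ψ(𝕎′_𝔸)ᶜᵒⁿᵗ`, `p ↦ relabel_C (q p q⁻¹)`.** [cite: MoeglinVignerasWaldspurger1987, Chap. 2 II.1 (B)] -/
def congrMp :
    adelicMpCont F (Fin n) (adelicGram F e TV TW) →* adelicMpCont F (Fin n) (adelicGram F e (PVᵀ * TV * PV) (PWᵀ * TW * PW)) :=
  (congrMpRelabel F e hVd hWd hPV hPW).toMonoidHom.comp
    (leviConj F (adelicGram F e TV TW) (isUnit_det_adelicGram F e hVd hWd) (ratGL F (gramGL F e hPV hPW)⁻¹))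

/-- formula. [cite: GelbartRogawski1991, §3.1 p. 454 L21–42] -/
theorem congrMp_apply (p : adelicMpCont F (Fin n) (adelicGram F e TV TW)) :
    congrMp F e hVd hWd hPV hPW p =
      congrMpRelabel F e hVd hWd hPV hPW
        (leviConj F (adelicGram F e TV TW) (isUnit_det_adelicGram F e hVd hWd) (ratGL F (gramGL F e hPV hPW)⁻¹) p) := rfl

/-- `φ` is continuous. [cite: Weil1964, Chap. III n° 39 p. 189] -/
theorem continuous_congrMp : Continuous (congrMp F e hVd hWd hPV hPW) :=
  (continuous_adelicMpContRelabel F (Fin n) _ _).comp (continuous_leviConj F _ _ _)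

/-- **`π′ ∘ φ = eSp ∘ π`.** [cite: MoeglinVignerasWaldspurger1987, Chap. 2 II.1 (B)] -/
theorem proj_congrMp (m : adelicMpCont F (Fin n) (adelicGram F e TV TW)) :
    adelicMpCont.proj F (Fin n) _ (congrMp F e hVd hWd hPV hPW m) =
      congrSp F e hVd hWd hPV hPW (adelicMpCont.proj F (Fin n) _ m) :=
  ((congrArg (adelicMpCont.proj F (Fin n) _) (congrMp_apply F e hVd hWd hPV hPW m)).trans
    (proj_congrMpRelabel F e hVd hWd hPV hPW _)).trans
    ((congrArg (congrSpRelabel F e hVd hWd hPV hPW) (proj_leviConj F _ _ _ m)).trans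
      (congrSp_apply F e hVd hWd hPV hPW _).symm)

/-- **the rational symplectic points correspond**: `eSp (ratSp_𝕋 A) = ratSp_{𝕋′} (m(𝕡⁻¹) A m(𝕡⁻¹)⁻¹)`.
[cite: GelbartRogawski1991, §3.1 p. 454 L35–36] -/
theorem congrSp_ratSp (A : Matrix.symplecticGroup (Fin n) F) :
    congrSp F e hVd hWd hPV hPW (ratSp F _ (isUnit_det_adelicGram F e hVd hWd) A) =
      ratSp F _ (isUnit_det_adelicGram_congr F e hVd hWd hPV hPW) (MulAut.conj (levi (gramGL F e hPV hPW)⁻¹) A) := by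
  have hi : (ratSp F _ (isUnit_det_adelicGram F e hVd hWd) (levi (gramGL F e hPV hPW)⁻¹))⁻¹ =
      ratSp F _ (isUnit_det_adelicGram F e hVd hWd) (levi (gramGL F e hPV hPW)⁻¹)⁻¹ :=
    (MonoidHom.map_inv (ratSp F _ (isUnit_det_adelicGram F e hVd hWd)) _).symm
  have hm : ratSp F _ (isUnit_det_adelicGram F e hVd hWd) (levi (gramGL F e hPV hPW)⁻¹) *
        ratSp F _ (isUnit_det_adelicGram F e hVd hWd) A *
        (ratSp F _ (isUnit_det_adelicGram F e hVd hWd) (levi (gramGL F e hPV hPW)⁻¹))⁻¹ =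
      ratSp F _ (isUnit_det_adelicGram F e hVd hWd)
        (levi (gramGL F e hPV hPW)⁻¹ * A * (levi (gramGL F e hPV hPW)⁻¹)⁻¹) := by
    rw [hi]
    exact ((MonoidHom.map_mul (ratSp F _ (isUnit_det_adelicGram F e hVd hWd)) _ _).trans
      (congrArg₂ (· * ·) (MonoidHom.map_mul (ratSp F _ (isUnit_det_adelicGram F e hVd hWd)) _ _) rfl)).symm
  have hc := congrArg (fun g => congrSpRelabel F e hVd hWd hPV hPW
      (g * ratSp F _ (isUnit_det_adelicGram F e hVd hWd) A * g⁻¹)) (proj_congrLeviPair F e hVd hWd hPV hPW)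
  exact ((congrSp_apply F e hVd hWd hPV hPW _).trans hc).trans
    ((congrArg (congrSpRelabel F e hVd hWd hPV hPW) hm).trans (congrSpRelabel_ratSp F e hVd hWd hPV hPW _))

/-- **`e₀ : Sp_F(𝕎) ≃* Sp_F(𝕎′)`** induced by `eSp` on the rational points (`A ↦ m(𝕡⁻¹) A m(𝕡⁻¹)⁻¹` on `Sp_{2n}(F)`).
[cite: GelbartRogawski1991, §3.1 p. 454 L35–36] -/
def congrSpRat :
    (ratSp F _ (isUnit_det_adelicGram F e hVd hWd)).range ≃*
      (ratSp F (adelicGram F e (PVᵀ * TV * PV) (PWᵀ * TW * PW)) (isUnit_det_adelicGram_congr F e hVd hWd hPV hPW)).range :=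
  ((MonoidHom.ofInjective (ratSp_injective F _ (isUnit_det_adelicGram F e hVd hWd))).symm.trans
    (MulAut.conj (levi (gramGL F e hPV hPW)⁻¹))).trans
    (MonoidHom.ofInjective (ratSp_injective F _ (isUnit_det_adelicGram_congr F e hVd hWd hPV hPW)))

/-- `e₀` is the restriction of `eSp`. [cite: GelbartRogawski1991, §3.1 p. 454 L21–42] -/
theorem coe_congrSpRat (x : (ratSp F _ (isUnit_det_adelicGram F e hVd hWd)).range) :
    ((congrSpRat F e hVd hWd hPV hPW x :
        (ratSp F (adelicGram F e (PVᵀ * TV * PV) (PWᵀ * TW * PW)) (isUnit_det_adelicGram_congr F e hVd hWd hPV hPW)).range) :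
      symplecticGroup (polar (adelicForm F (Fin n) (adelicGram F e (PVᵀ * TV * PV) (PWᵀ * TW * PW))))) =
      congrSp F e hVd hWd hPV hPW x := by
  have hx := MonoidHom.apply_ofInjective_symm (ratSp_injective F _ (isUnit_det_adelicGram F e hVd hWd)) x
  conv_rhs => rw [← hx]
  rw [congrSp_ratSp]
  rfl

/-- the splitting datum of the ORIGINAL Gram data `(T_V, T_W)` (abbreviation). [cite: GelbartRogawski1991, §3.1 p. 454 L21–48] -/
abbrev origDatum :=
  splittingDatum F E c N M e (TV.map (algebraMap F E)) (TW.map (algebraMap F E)) hcδ hδ hd hV hW hVd hWd rfl rfl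

/-- the splitting datum of the CONGRUENT Gram data `(P_Vᵀ T_V P_V, P_Wᵀ T_W P_W)` (abbreviation).
[cite: GelbartRogawski1991, §3.1 p. 454 L21–48] -/
abbrev congrDatum :=
  splittingDatum F E c N M e ((PVᵀ * TV * PV).map (algebraMap F E)) ((PWᵀ * TW * PW).map (algebraMap F E)) hcδ hδ hd
    (isSymm_congr hV PV) (isSymm_congr hW PW) (isUnit_det_congr hVd hPV) (isUnit_det_congr hWd hPW) rfl rfl

/-- `hproj` in datum form. [cite: GelbartRogawski1991, §3.1 p. 454 L21–42] -/
theorem congrDatum_proj_congrMp (m : adelicMpCont F (Fin n) (adelicGram F e TV TW)) :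
    (congrDatum F E c e hcδ hδ hd hV hW hVd hWd hPV hPW).proj (congrMp F e hVd hWd hPV hPW m) =
      congrSp F e hVd hWd hPV hPW ((origDatum F E c e hcδ hδ hd hV hW hVd hWd).proj m) :=
  proj_congrMp F e hVd hWd hPV hPW m

/-- `hrat` in datum form. [cite: GelbartRogawski1991, §3.1 p. 454 L21–42] -/
theorem congrDatum_ratPts
    (γ' : UnitaryGroup.adelicPair F E c N M ((PVᵀ * TV * PV).map (algebraMap F E)) ((PWᵀ * TW * PW).map (algebraMap F E)))
    (hγ' : γ' ∈ (congrDatum F E c e hcδ hδ hd hV hW hVd hWd hPV hPW).ratPts) :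
    (congrPair F E c N M hPV hPW TV TW).toMonoidHom γ' ∈ (origDatum F E c e hcδ hδ hd hV hW hVd hWd).ratPts := by
  obtain ⟨γ, rfl⟩ := MonoidHom.mem_range.1 hγ'
  exact congrPair_rationalPairToAdelic_mem_range F E c N M hPV hPW TV TW γ

/-- `he₀` in datum form. [cite: GelbartRogawski1991, §3.1 p. 454 L21–42] -/
theorem congrDatum_coe_congrSpRat (x : (origDatum F E c e hcδ hδ hd hV hW hVd hWd).spRat) :
    ((congrSpRat F e hVd hWd hPV hPW x : (congrDatum F E c e hcδ hδ hd hV hW hVd hWd hPV hPW).spRat) :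
      symplecticGroup (polar (adelicForm F (Fin n) (adelicGram F e (PVᵀ * TV * PV) (PWᵀ * TW * PW))))) =
      congrSp F e hVd hWd hPV hPW x :=
  coe_congrSpRat F e hVd hWd hPV hPW x

end Transport

end UnitaryDualPair

end Literature.NumberTheory.GelbartRogawski1991

end
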